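import Summits.Schanuel.Schanuel.Theorems.RootDecomp1BMovingZero09

/-!
# RootDecomp1BMovingZero — lens 4, generation 35/36 «AX-TRANSVERSAL MOVING ZERO»: T″ = `IsolatedIntersectionGeneral` PROVED modulo ONE print fact (`CurveSelection`) + the tree Ax statement, and SUB-PIECE A = `AnalyticMovingZero` PROVED modulo TWO print facts (`RoucheMaps`, `IsolatedZeroLowerBound`) — continuation (RootDecomp1BMovingZero10): §T (2/2) THE ASSEMBLY: `isolatedIntersectionGeneral_of_inputs`, `isolatedIntersectionGeneral_of_curveSelection : CurveSelection → AxRankBoundLaurent → IsolatedIntersectionGeneral`, `isolatedIntersection_of_curveSelection`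

(lens-4 g35 HOME kernels MovingZeroTpp.lean 6bf08f88…de4e (2338 l = §G03 MovingZeroGeneral03 b461aa70… + §E MovingZeroExpPoly fdd5ca6b… + §X MovingZeroAxGerms a74f0949… verbatim
bodies + NEW §T) and MovingZeroPieceA.lean 8899dedb…8da9 (238 l); ADDENDUM-2 L1857, writer re-check L1858, critic RULING L1859 (T″ VERIFIED and BOOKED; `CurveSelection`
ACCEPTED as THE ONE T-fact), RESULT/DONE L1865, critic RULING/ADDENDUM L1867 (A VERIFIED and BOOKED; `RoucheMaps` / `IsolatedZeroLowerBound` ACCEPTED AS TYPED),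
lens-4 g36 NOTE/CLAIM L1871 (PORT-READY) and critic ACK L1875 (PORT STAGING GO; credits T (L1859) and A (L1867) paid at the critic's verification of the
accepted parts carrying `isolatedIntersectionGeneral_of_curveSelection` resp. `analyticMovingZero_of_facts`); port by census-1 gen 17 as `RootDecomp1BMovingZero03`–`10`
PORT EDITS: the 44 `#guard_msgs in #print axioms` guards and their section headers dropped (HOME probes); `set_option linter.dupNamespace false` dropped; PieceA's
character-identical copy of `AnalyticMovingZero` dropped (§A's definition is used; its Facts + Proof sections follow §A in part 04); the four re-proved
`AxSchanuelTwoGerms` helpers (`exists_algDerivation_eq_derivative'`, `ofPowerSeries_taylor_exp_ne_zero'`, `algebraMap_eq_ofPowerSeries_C'`, `taylor_const'`) PRIVATE in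
part 08 (statement-twins of the unbuilt Literature module) with a notation-free private copy `taylor_const''` in part 09; `CurveSelection`'s docstring replaced by the
FACT (T-ii) text dictated in L1871 (ACK L1875); the three fact docstrings' cite KEYS normalised to references.bib (`Chirka1989`, `DAngeloSCV1993` — the gate's cite-key lint), locators unchanged; nine one-line docstrings added; statements and proofs otherwise verbatim; `AxRankBoundLaurent` stays a binder BY
NAME (discharge: HOME MovingZeroAxGermsTree.lean c3203867… once `AxSchanuelUniv` builds on the farm). `--supports stmt-Schanuel-32406`; no census credit carried;
rung 0 — nothing here proves Schanuel.)
-/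

noncomputable section

namespace Summit.Schanuel.Schanuel.Theorems.RootDecomp1BMovingZero

section TppMain

open Complex Filter Topology
open Literature.NumberTheory.Transcendental.AndreCriterion (taylor_congr)

local notation3 "𝓣[" f "]" =>
  (PowerSeries.mk fun n => ((Nat.factorial n : ℂ)⁻¹ * iteratedDeriv n f 0) : PowerSeries ℂ)

local notation3 "𝓛[" f "]" => (HahnSeries.ofPowerSeries ℤ ℂ 𝓣[f] : LaurentSeries ℂ)

/-- INPUT X of the T″-assembly — the Ax ALTERNATIVE for two analytic germs and their `ρ`-multiples (= §X
`const_or_logLine_of_isAlgebraic_taylor hAx`, `hAx : AxRankBoundLaurent` = tree `Ax1971.add_rank_le_trdeg_of_field`). -/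
def ConstOrLogLine : Prop :=
  ∀ {ρ : ℝ}, Irrational ρ → ∀ {x y : ℂ → ℂ}, AnalyticAt ℂ x 0 → AnalyticAt ℂ y 0 →
    ∀ (s : Finset (LaurentSeries ℂ)), s.card ≤ 4 →
      𝓛[x] ∈ Algebra.adjoin ℂ (s : Set (LaurentSeries ℂ)) → 𝓛[y] ∈ Algebra.adjoin ℂ (s : Set (LaurentSeries ℂ)) →
      IsAlgebraic (Algebra.adjoin ℂ (s : Set (LaurentSeries ℂ))) 𝓛[fun z => cexp (x z)] →
      IsAlgebraic (Algebra.adjoin ℂ (s : Set (LaurentSeries ℂ))) 𝓛[fun z => cexp (y z)] →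
      IsAlgebraic (Algebra.adjoin ℂ (s : Set (LaurentSeries ℂ))) 𝓛[fun z => cexp ((ρ : ℂ) * x z)] →
      IsAlgebraic (Algebra.adjoin ℂ (s : Set (LaurentSeries ℂ))) 𝓛[fun z => cexp ((ρ : ℂ) * y z)] →
        (∃ c : ℂ, ∀ᶠ z in 𝓝 (0 : ℂ), x z = c) ∨
          (∃ (lam : ℝ) (c : ℂ), ∀ᶠ z in 𝓝 (0 : ℂ), y z = (lam : ℂ) * x z + c)

/-- INPUT V of the T″-assembly — the VERTICAL-CASE core (= §E `poly_family_eq_zero_of_expSum`). -/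
def PolyFamilyZero : Prop :=
  ∀ {K : ℕ} {ρ : ℝ}, Irrational ρ → ∀ (g : Fin (K + 1) → Polynomial ℂ) {y₀ : ℂ},
    (∀ᶠ y in 𝓝 y₀, ∑ k : Fin (K + 1), (g k).eval (cexp y) * cexp (((k : ℕ) : ℂ) * (ρ : ℂ) * y) = 0) →
      ∀ k, g k = 0

/-- INPUT L of the T″-assembly — the LOG-LINE lemma, all slopes (= §E `logLine_top_coeff_eq_zero`). -/
def LogLineTopCoeff : Prop :=
  ∀ {K₁ K₂ : ℕ} {ρ : ℝ}, LinearIndependent ℚ ![(1 : ℝ), ρ, ρ ^ 2] → ∀ (lam : ℝ) {c₀ c₁ : ℂ}, c₀ ≠ 0 → c₁ ≠ 0 →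
    ∀ (g₁ : Fin (K₁ + 1) → MvPolynomial (Fin 2) ℂ) (g₂ : Fin (K₂ + 1) → MvPolynomial (Fin 2) ℂ) {x₀ : ℂ},
      (∀ᶠ x in 𝓝 x₀, ∑ k : Fin (K₁ + 1),
        MvPolynomial.eval ![cexp x, c₀ * cexp ((lam : ℂ) * x)] (g₁ k) * cexp (((k : ℕ) : ℂ) * (ρ : ℂ) * x) = 0) →
      (∀ᶠ x in 𝓝 x₀, ∑ k : Fin (K₂ + 1),
        MvPolynomial.eval ![cexp x, c₀ * cexp ((lam : ℂ) * x)] (g₂ k) *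
          (c₁ ^ (k : ℕ) * cexp (((k : ℕ) : ℂ) * ((lam * ρ : ℝ) : ℂ) * x)) = 0) →
      MvPolynomial.eval ![cexp x₀, c₀ * cexp ((lam : ℂ) * x₀)] (g₁ (Fin.last K₁)) = 0 ∨
        MvPolynomial.eval ![cexp x₀, c₀ * cexp ((lam : ℂ) * x₀)] (g₂ (Fin.last K₂)) = 0

/-! ### pointwise bookkeeping: the curve equations along the three kinds of branches -/

/-- Analyticity of the curve pair in `w = (X, Y)` at fixed `t`, off the cut. -/
theorem analyticAt_curveΦ_w {K₁ K₂ : ℕ} (G₁ : Fin (K₁ + 1) → MvPolynomial (Fin 3) ℤ)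
    (G₂ : Fin (K₂ + 1) → MvPolynomial (Fin 3) ℤ) (t : ℂ) {X₀ Y₀ : ℂ} (hX : X₀ ∈ slitPlane) (hY : Y₀ ∈ slitPlane) :
    AnalyticAt ℂ (curveΦ G₁ G₂ t) (X₀, Y₀) := by
  have hv : ∀ i : Fin 3, AnalyticAt ℂ (fun p : ℂ × ℂ => (![t, p.1, p.2] : Fin 3 → ℂ) i) (X₀, Y₀) := by
    intro i
    refine Fin.cases ?_ (fun j => ?_) i
    · simp only [Matrix.cons_val_zero]; exact analyticAt_const
    · refine Fin.cases ?_ (fun k => ?_) j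
      · simp only [Matrix.cons_val_succ, Matrix.cons_val_zero]; exact analyticAt_fst
      · refine Fin.cases ?_ (fun l => l.elim0) k
        simp only [Matrix.cons_val_succ, Matrix.cons_val_zero]; exact analyticAt_snd
  refine AnalyticAt.prod ?_ ?_
  · show AnalyticAt ℂ (fun p : ℂ × ℂ => relEval G₁ t p.1 p.2 (cexp (t * Complex.log p.1))) (X₀, Y₀)
    unfold relEval
    refine Finset.analyticAt_fun_sum _ (fun k _ => ?_)
    exact (AnalyticAt.aeval_mvPolynomial hv (G₁ k)).mul
      ((analyticAt_const.mul ((analyticAt_fst (p := (X₀, Y₀))).clog hX)).cexp'.pow _)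
  · show AnalyticAt ℂ (fun p : ℂ × ℂ => relEval G₂ t p.1 p.2 (cexp (t * Complex.log p.2))) (X₀, Y₀)
    unfold relEval
    refine Finset.analyticAt_fun_sum _ (fun k _ => ?_)
    exact (AnalyticAt.aeval_mvPolynomial hv (G₂ k)).mul
      ((analyticAt_const.mul ((analyticAt_snd (p := (X₀, Y₀))).clog hY)).cexp'.pow _)

/-- VERTICAL branch `X ≡ X₀`, `Y = e^{u}`, `Y^ρ = e^{ρu}`: the second curve in the `PolyFamilyZero` currency. -/
theorem relEval_vertical {K : ℕ} (G : Fin (K + 1) → MvPolynomial (Fin 3) ℤ) (ρ : ℝ) (X₀ u : ℂ) :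
    relEval G ρ X₀ (cexp u) (cexp (ρ * u)) =
      ∑ k : Fin (K + 1), (specTX ρ X₀ (G k)).eval (cexp u) * cexp (((k : ℕ) : ℂ) * (ρ : ℂ) * u) := by
  unfold relEval
  refine Finset.sum_congr rfl (fun k _ => ?_)
  rw [eval_specTX, mul_assoc (((k : ℕ) : ℂ)), Complex.exp_nat_mul]

/-- Analyticity in `u` of `relEval G ρ X₀ (e^u) (e^{ρu})` (the vertical branch). -/
theorem analyticAt_relEval_vertical {K : ℕ} (G : Fin (K + 1) → MvPolynomial (Fin 3) ℤ) (ρ : ℝ) (X₀ u₀ : ℂ) :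
    AnalyticAt ℂ (fun u => relEval G ρ X₀ (cexp u) (cexp (ρ * u))) u₀ := by
  unfold relEval
  refine Finset.analyticAt_fun_sum _ (fun k _ => ?_)
  exact (AnalyticAt.aeval_mvPolynomial (analyticAt_vec3_of analyticAt_const analyticAt_const analyticAt_cexp)
    (G k)).mul ((analyticAt_const.mul analyticAt_id).cexp'.pow _)

/-- The power identity of the log-line branch: `(e^{ρc})^k · e^{k·lamρ·u} = (e^{ρ(lam u + c)})^k`. -/
theorem pow_logLine (ρ lam : ℝ) (c u : ℂ) (k : ℕ) :
    cexp ((ρ : ℂ) * c) ^ k * cexp ((k : ℂ) * ((lam * ρ : ℝ) : ℂ) * u) =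
      cexp ((ρ : ℂ) * ((lam : ℂ) * u + c)) ^ k := by
  rw [mul_assoc ((k : ℕ) : ℂ), Complex.exp_nat_mul, ← mul_pow, ← Complex.exp_add]
  congr 1
  congr 1
  push_cast
  ring

/-- LOG-LINE branch `X = e^{u}`, `Y = e^{lam u + c}`, `X^ρ = e^{ρu}`: the first curve in the `LogLineTopCoeff` currency. -/
theorem relEval_logLine₁ {K : ℕ} (G : Fin (K + 1) → MvPolynomial (Fin 3) ℤ) (ρ lam : ℝ) (c u : ℂ) :
    relEval G ρ (cexp u) (cexp ((lam : ℂ) * u + c)) (cexp ((ρ : ℂ) * u)) =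
      ∑ k : Fin (K + 1), MvPolynomial.eval ![cexp u, cexp c * cexp ((lam : ℂ) * u)] (specT ρ (G k)) *
        cexp (((k : ℕ) : ℂ) * (ρ : ℂ) * u) := by
  unfold relEval
  refine Finset.sum_congr rfl (fun k _ => ?_)
  rw [eval_specT, mul_assoc (((k : ℕ) : ℂ)), Complex.exp_nat_mul, Complex.exp_add, mul_comm (cexp ((lam : ℂ) * u))]

/-- LOG-LINE branch, second curve (`Y^ρ = e^{ρ(lam u + c)} = e^{ρc} e^{lamρ·u}`). -/
theorem relEval_logLine₂ {K : ℕ} (G : Fin (K + 1) → MvPolynomial (Fin 3) ℤ) (ρ lam : ℝ) (c u : ℂ) :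
    relEval G ρ (cexp u) (cexp ((lam : ℂ) * u + c)) (cexp ((ρ : ℂ) * ((lam : ℂ) * u + c))) =
      ∑ k : Fin (K + 1), MvPolynomial.eval ![cexp u, cexp c * cexp ((lam : ℂ) * u)] (specT ρ (G k)) *
        (cexp ((ρ : ℂ) * c) ^ (k : ℕ) * cexp (((k : ℕ) : ℂ) * ((lam * ρ : ℝ) : ℂ) * u)) := by
  unfold relEval
  refine Finset.sum_congr rfl (fun k _ => ?_)
  rw [eval_specT, pow_logLine, Complex.exp_add ((lam : ℂ) * u) c, mul_comm (cexp ((lam : ℂ) * u))]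

/-- Analyticity of `u ↦ p(f u, g u)` for a polynomial `p` and analytic `f, g`. -/
theorem analyticAt_eval_vec2 {f g : ℂ → ℂ} {u₀ : ℂ} (hf : AnalyticAt ℂ f u₀) (hg : AnalyticAt ℂ g u₀)
    (p : MvPolynomial (Fin 2) ℂ) : AnalyticAt ℂ (fun u => MvPolynomial.eval ![f u, g u] p) u₀ := by
  induction p using MvPolynomial.induction_on with
  | C a => simp_rw [MvPolynomial.eval_C]; exact analyticAt_const
  | add p q hp hq => simp_rw [map_add]; exact hp.add hq
  | mul_X p i ih => simp_rw [map_mul, MvPolynomial.eval_X]; exact ih.mul (analyticAt_vec2_of hf hg i)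

/-- Analyticity in `u` of the first relation along a log-line branch. -/
theorem analyticAt_logLine₁ {K : ℕ} (g : Fin (K + 1) → MvPolynomial (Fin 2) ℂ) (ρ lam : ℝ) (c₀ u₀ : ℂ) :
    AnalyticAt ℂ (fun u => ∑ k : Fin (K + 1),
      MvPolynomial.eval ![cexp u, c₀ * cexp ((lam : ℂ) * u)] (g k) * cexp (((k : ℕ) : ℂ) * (ρ : ℂ) * u)) u₀ := by
  refine Finset.analyticAt_fun_sum _ (fun k _ => ?_)
  exact (analyticAt_eval_vec2 analyticAt_cexp (analyticAt_const.mul (analyticAt_const.mul analyticAt_id).cexp')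
    (g k)).mul ((analyticAt_const.mul analyticAt_id).cexp')

/-- Analyticity in `u` of the second relation along a log-line branch. -/
theorem analyticAt_logLine₂ {K : ℕ} (g : Fin (K + 1) → MvPolynomial (Fin 2) ℂ) (ρ lam : ℝ) (c₀ c₁ u₀ : ℂ) :
    AnalyticAt ℂ (fun u => ∑ k : Fin (K + 1),
      MvPolynomial.eval ![cexp u, c₀ * cexp ((lam : ℂ) * u)] (g k) *
        (c₁ ^ (k : ℕ) * cexp (((k : ℕ) : ℂ) * ((lam * ρ : ℝ) : ℂ) * u))) u₀ := by
  refine Finset.analyticAt_fun_sum _ (fun k _ => ?_)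
  exact (analyticAt_eval_vec2 analyticAt_cexp (analyticAt_const.mul (analyticAt_const.mul analyticAt_id).cexp')
    (g k)).mul (analyticAt_const.mul ((analyticAt_const.mul analyticAt_id).cexp'))

/-! ### THE ASSEMBLY -/

/-- **T″ = `IsolatedIntersectionGeneral` from the three analytic inputs and the curve-selection fact.**
Proof (NODE.md §3/§8–§11): if the intersection at `θ′` were not isolated, curve selection gives a non-constant
analytic germ `γ = (X, Y)` through `θ′` inside both curves; with `x = log X`, `y = log Y` (principal branches,
analytic since `θ′` is off the cut) the curve equations are exponential-polynomial identities in `s`.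
VERTICAL (`X ≡ X₀`): the second curve gives `Σ_k G₂ₖ(ρ, X₀, e^{u}) e^{kρu} ≡ 0` near `u = log Y₀`
(push-forward along the non-constant `y`, identity theorem), so INPUT V kills every `G₂ₖ(ρ, X₀, ·)`, contradicting
genuineness.  Otherwise the Taylor series of `e^{ρx}, e^{ρy}` are algebraic over `ℂ[𝓣x, 𝓣y, 𝓣X, 𝓣Y]` (the curve
equations, top coefficient non-zero AT `θ′` by genuineness), so INPUT X (Ax) gives `x` constant — excluded — or a
LOG LINE `y = lam·x + c`, `lam ∈ ℝ`; along it both curves become the identities of INPUT L near `u = log X₀`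
(push-forward along the non-constant `x`, identity theorem), whose conclusion is `¬ GenuineAt`. -/
theorem isolatedIntersectionGeneral_of_inputs (hCS : CurveSelection) (hAX : ConstOrLogLine)
    (hV : PolyFamilyZero) (hL : LogLineTopCoeff) : IsolatedIntersectionGeneral := by
  classical
  intro ρ h3 X₀ Y₀ hX₀ hY₀ K₁ K₂ G₁ G₂ hgen
  have hρ : Irrational ρ := irrational_of_linearIndependent_one_rho_sq h3
  by_contra hiso
  -- Step 1: θ′ is a non-isolated zero of the curve pair
  have hfreq := frequently_zero_of_not_isolatedAt' hiso
  have hΦan : AnalyticAt ℂ (curveΦ G₁ G₂ ρ) (X₀, Y₀) := analyticAt_curveΦ_w G₁ G₂ ρ hX₀ hY₀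
  have hΦ0 : curveΦ G₁ G₂ ρ (X₀, Y₀) = 0 := eq_zero_of_frequently hΦan.continuousAt hfreq
  -- Step 2: curve selection
  obtain ⟨γ, hγan, hγ0, hγnc, hγZ⟩ := hCS _ _ hΦan hΦ0 hfreq
  have hXan : AnalyticAt ℂ (fun s => (γ s).1) 0 := analyticAt_fst.comp hγan
  have hYan : AnalyticAt ℂ (fun s => (γ s).2) 0 := analyticAt_snd.comp hγan
  have hX0 : (γ 0).1 = X₀ := by rw [hγ0]
  have hY0 : (γ 0).2 = Y₀ := by rw [hγ0]
  have hxan : AnalyticAt ℂ (fun s => Complex.log (γ s).1) 0 := hXan.clog (by simpa [hγ0] using hX₀)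
  have hyan : AnalyticAt ℂ (fun s => Complex.log (γ s).2) 0 := hYan.clog (by simpa [hγ0] using hY₀)
  have hXsl : ∀ᶠ s in 𝓝 0, (γ s).1 ∈ slitPlane :=
    hXan.continuousAt.eventually_mem (isOpen_slitPlane.mem_nhds (by simpa [hγ0] using hX₀))
  have hYsl : ∀ᶠ s in 𝓝 0, (γ s).2 ∈ slitPlane :=
    hYan.continuousAt.eventually_mem (isOpen_slitPlane.mem_nhds (by simpa [hγ0] using hY₀))
  have hXexp : ∀ᶠ s in 𝓝 0, cexp (Complex.log (γ s).1) = (γ s).1 :=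
    hXsl.mono fun s hs => Complex.exp_log (slitPlane_ne_zero hs)
  have hYexp : ∀ᶠ s in 𝓝 0, cexp (Complex.log (γ s).2) = (γ s).2 :=
    hYsl.mono fun s hs => Complex.exp_log (slitPlane_ne_zero hs)
  have hrel : ∀ᶠ s in 𝓝 0, relEval G₁ ρ (γ s).1 (γ s).2 (cexp (ρ * Complex.log (γ s).1)) = 0 ∧
      relEval G₂ ρ (γ s).1 (γ s).2 (cexp (ρ * Complex.log (γ s).2)) = 0 :=
    hγZ.mono fun s hs => by simpa only [curveΦ, Prod.mk_eq_zero] using hs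
  by_cases hxc : ∀ᶠ s in 𝓝 0, (γ s).1 = X₀
  · /- VERTICAL CASE -/
    have hYnc : ¬ ∀ᶠ s in 𝓝 0, (γ s).2 = Y₀ := fun hyc => hγnc (by
      filter_upwards [hxc, hyc] with s h1 h2
      exact Prod.ext h1 h2)
    have hync : ¬ ∀ᶠ s in 𝓝 0, Complex.log (γ s).2 = Complex.log Y₀ := fun hyc => hYnc (by
      filter_upwards [hyc, hYexp] with s h1 h2
      rw [← h2, h1]
      exact Complex.exp_log (slitPlane_ne_zero hY₀))
    have hyt : Tendsto (fun s => Complex.log (γ s).2) (𝓝 0) (𝓝 (Complex.log Y₀)) := by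
      have h := hyan.continuousAt.tendsto
      simpa [hγ0] using h
    have hP : ∀ᶠ s in 𝓝 0, relEval G₂ ρ X₀ (cexp (Complex.log (γ s).2)) (cexp (ρ * Complex.log (γ s).2)) = 0 := by
      filter_upwards [hrel, hxc, hYexp] with s hs h1 h2
      rw [h2, ← h1]
      exact hs.2
    have hfreqP := frequently_nhdsNE_of_eventually_comp
      (P := fun u => relEval G₂ ρ X₀ (cexp u) (cexp (ρ * u)) = 0) hyt hync hP
    have hPev : ∀ᶠ u in 𝓝 (Complex.log Y₀), relEval G₂ ρ X₀ (cexp u) (cexp (ρ * u)) = 0 :=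
      (analyticAt_relEval_vertical G₂ ρ X₀ _).frequently_zero_iff_eventually_zero.mp hfreqP
    have hfam : ∀ᶠ u in 𝓝 (Complex.log Y₀), ∑ k : Fin (K₂ + 1),
        (specTX ρ X₀ (G₂ k)).eval (cexp u) * cexp (((k : ℕ) : ℂ) * (ρ : ℂ) * u) = 0 :=
      hPev.mono fun u hu => by rwa [relEval_vertical] at hu
    have hzero := hV hρ (fun k => specTX ρ X₀ (G₂ k)) hfam (Fin.last K₂)
    apply hgen.2
    rw [← eval_specTX (ρ : ℂ) X₀ Y₀, hzero, Polynomial.eval_zero]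
  · /- NON-VERTICAL: Ax -/
    have hxnc : ¬ ∀ᶠ s in 𝓝 0, Complex.log (γ s).1 = Complex.log X₀ := fun h => hxc (by
      filter_upwards [h, hXexp] with s h1 h2
      rw [← h2, h1]
      exact Complex.exp_log (slitPlane_ne_zero hX₀))
    have hxt : Tendsto (fun s => Complex.log (γ s).1) (𝓝 0) (𝓝 (Complex.log X₀)) := by
      have h := hxan.continuousAt.tendsto
      simpa [hγ0] using h
    -- the four Taylor series and the subalgebra they generate
    set S : Finset (LaurentSeries ℂ) := {𝓛[fun s => Complex.log (γ s).1], 𝓛[fun s => Complex.log (γ s).2],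
      𝓛[fun s => (γ s).1], 𝓛[fun s => (γ s).2]} with hSdef
    have hS : S.card ≤ 4 := Finset.card_le_four
    set A : Subalgebra ℂ (LaurentSeries ℂ) := Algebra.adjoin ℂ (S : Set (LaurentSeries ℂ)) with hAdef
    have hxA : 𝓛[fun s => Complex.log (γ s).1] ∈ A := Algebra.subset_adjoin (by simp [hSdef])
    have hyA : 𝓛[fun s => Complex.log (γ s).2] ∈ A := Algebra.subset_adjoin (by simp [hSdef])
    have hXA : 𝓛[fun s => (γ s).1] ∈ A := Algebra.subset_adjoin (by simp [hSdef])
    have hYA : 𝓛[fun s => (γ s).2] ∈ A := Algebra.subset_adjoin (by simp [hSdef])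
    -- algebraicity of e^x, e^y (they ARE X, Y near 0)
    have hEx : IsAlgebraic A 𝓛[fun z => cexp (Complex.log (γ z).1)] := by
      rw [taylor_congr hXexp]
      exact isAlgebraic_algebraMap (⟨_, hXA⟩ : A)
    have hEy : IsAlgebraic A 𝓛[fun z => cexp (Complex.log (γ z).2)] := by
      rw [taylor_congr hYexp]
      exact isAlgebraic_algebraMap (⟨_, hYA⟩ : A)
    -- algebraicity of e^{ρx}, e^{ρy}: the curve equations, top coefficients non-zero AT θ′ (genuineness)
    have hc₁ := fun k => analyticAt_and_taylor_aeval_mem hXan hYan (ρ : ℂ) A hXA hYA (G₁ k)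
    have hc₂ := fun k => analyticAt_and_taylor_aeval_mem hXan hYan (ρ : ℂ) A hXA hYA (G₂ k)
    have hEρx : IsAlgebraic A 𝓛[fun z => cexp ((ρ : ℂ) * Complex.log (γ z).1)] :=
      isAlgebraic_taylor_of_relation A (fun k => (hc₁ k).1) ((analyticAt_const.mul hxan).cexp')
        (fun k => (hc₁ k).2) (by simpa [hγ0] using hgen.1) (hrel.mono fun s hs => hs.1)
    have hEρy : IsAlgebraic A 𝓛[fun z => cexp ((ρ : ℂ) * Complex.log (γ z).2)] :=
      isAlgebraic_taylor_of_relation A (fun k => (hc₂ k).1) ((analyticAt_const.mul hyan).cexp')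
        (fun k => (hc₂ k).2) (by simpa [hγ0] using hgen.2) (hrel.mono fun s hs => hs.2)
    rcases hAX hρ hxan hyan S hS hxA hyA hEx hEy hEρx hEρy with ⟨c, hc⟩ | ⟨lam, c, hll⟩
    · -- `x` eventually constant: excluded in this case
      apply hxnc
      have hc0 : Complex.log (γ 0).1 = c := hc.self_of_nhds
      filter_upwards [hc] with s hs
      rw [hs, ← hc0, hγ0]
    · /- LOG-LINE CASE `y = lam·x + c` -/
      have hll0 : Complex.log Y₀ = (lam : ℂ) * Complex.log X₀ + c := by
        have h := hll.self_of_nhds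
        simpa [hγ0] using h
      have hP : ∀ᶠ s in 𝓝 0,
          (∑ k : Fin (K₁ + 1), MvPolynomial.eval ![cexp (Complex.log (γ s).1),
              cexp c * cexp ((lam : ℂ) * Complex.log (γ s).1)] (specT ρ (G₁ k)) *
            cexp (((k : ℕ) : ℂ) * (ρ : ℂ) * Complex.log (γ s).1) = 0) ∧
          (∑ k : Fin (K₂ + 1), MvPolynomial.eval ![cexp (Complex.log (γ s).1),
              cexp c * cexp ((lam : ℂ) * Complex.log (γ s).1)] (specT ρ (G₂ k)) *
            (cexp ((ρ : ℂ) * c) ^ (k : ℕ) * cexp (((k : ℕ) : ℂ) * ((lam * ρ : ℝ) : ℂ) * Complex.log (γ s).1)) = 0) := by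
        filter_upwards [hrel, hXexp, hYexp, hll] with s hs h1 h2 h3
        have e2 : (γ s).2 = cexp ((lam : ℂ) * Complex.log (γ s).1 + c) := by rw [← h3, h2]
        refine ⟨?_, ?_⟩
        · rw [← relEval_logLine₁ G₁ ρ lam c (Complex.log (γ s).1), ← e2, h1]
          exact hs.1
        · rw [← relEval_logLine₂ G₂ ρ lam c (Complex.log (γ s).1), ← e2, h1, ← h3]
          exact hs.2
      have hfreqP := frequently_nhdsNE_of_eventually_comp
        (P := fun u =>
          (∑ k : Fin (K₁ + 1), MvPolynomial.eval ![cexp u, cexp c * cexp ((lam : ℂ) * u)] (specT ρ (G₁ k)) *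
            cexp (((k : ℕ) : ℂ) * (ρ : ℂ) * u) = 0) ∧
          (∑ k : Fin (K₂ + 1), MvPolynomial.eval ![cexp u, cexp c * cexp ((lam : ℂ) * u)] (specT ρ (G₂ k)) *
            (cexp ((ρ : ℂ) * c) ^ (k : ℕ) * cexp (((k : ℕ) : ℂ) * ((lam * ρ : ℝ) : ℂ) * u)) = 0))
        hxt hxnc hP
      have h₁ := (analyticAt_logLine₁ (fun k => specT ρ (G₁ k)) ρ lam (cexp c)
        (Complex.log X₀)).frequently_zero_iff_eventually_zero.mp (hfreqP.mono fun u hu => hu.1)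
      have h₂ := (analyticAt_logLine₂ (fun k => specT ρ (G₂ k)) ρ lam (cexp c) (cexp ((ρ : ℂ) * c))
        (Complex.log X₀)).frequently_zero_iff_eventually_zero.mp (hfreqP.mono fun u hu => hu.2)
      have hbase₁ : cexp (Complex.log X₀) = X₀ := Complex.exp_log (slitPlane_ne_zero hX₀)
      have hbase₂ : cexp c * cexp ((lam : ℂ) * Complex.log X₀) = Y₀ := by
        rw [← Complex.exp_add, add_comm, ← hll0]
        exact Complex.exp_log (slitPlane_ne_zero hY₀)
      rcases hL h3 lam (Complex.exp_ne_zero c) (Complex.exp_ne_zero _) (fun k => specT ρ (G₁ k))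
          (fun k => specT ρ (G₂ k)) h₁ h₂ with hz | hz
      · apply hgen.1
        rw [← eval_specT (ρ : ℂ) X₀ Y₀, ← hbase₁, ← hbase₂]
        exact hz
      · apply hgen.2
        rw [← eval_specT (ρ : ℂ) X₀ Y₀, ← hbase₁, ← hbase₂]
        exact hz

end TppMain

section TppFinal

open Complex Filter Topology

/-- **T″ PROVED from ONE print fact + tree Ax.**  `IsolatedIntersectionGeneral` follows from `CurveSelection`
(print: Chirka §3.5/§6.1/§8.5) and `AxRankBoundLaurent` (= tree `Ax1971.add_rank_le_trdeg_of_field` at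
`(ℂ, ℂ⸨X⸩, 1)`; discharge `MovingZeroAxGermsTree.axRankBoundLaurent_holds`), the three analytic inputs of
`isolatedIntersectionGeneral_of_inputs` being the PROVED §X/§E theorems `const_or_logLine_of_isAlgebraic_taylor`,
`poly_family_eq_zero_of_expSum`, `logLine_top_coeff_eq_zero`. -/
theorem isolatedIntersectionGeneral_of_curveSelection (hCS : CurveSelection) (hAx : AxRankBoundLaurent) :
    IsolatedIntersectionGeneral :=
  isolatedIntersectionGeneral_of_inputs hCS
    (fun hρ _ _ hx hy s hs hsx hsy hEx hEy hEρx hEρy =>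
      const_or_logLine_of_isAlgebraic_taylor hAx hρ hx hy s hs hsx hsy hEx hEy hEρx hEρy)
    (fun hρ g _ h => poly_family_eq_zero_of_expSum hρ g h)
    (fun h3 lam _ _ hc₀ hc₁ g₁ g₂ _ h₁ h₂ => logLine_top_coeff_eq_zero h3 lam hc₀ hc₁ g₁ g₂ h₁ h₂)

/-- … hence the kernel's `IsolatedIntersection ρ` for EVERY `ρ` with `1, ρ, ρ²` free over `ℚ` — in particular for
the route's transcendental `ρ` (G-2 `isolatedIntersection_of_general` needs T″ only AT `θ = (e, e^i)`, where
genuineness is `genuineAt_theta`). -/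
theorem isolatedIntersection_of_curveSelection (hCS : CurveSelection) (hAx : AxRankBoundLaurent) (ρ : ℝ) :
    IsolatedIntersection ρ :=
  isolatedIntersection_of_general (isolatedIntersectionGeneral_of_curveSelection hCS hAx) ρ

end TppFinal

end Summit.Schanuel.Schanuel.Theorems.RootDecomp1BMovingZero

end
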